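import Summits.BirchSwinnertonDyer.Rank1Residual.P2.CongruentNumberPairsAtTwoPrimeSevenModEight
import Summits.BirchSwinnertonDyer.Rank1Residual.P2.CongruentNumberPairsAtTwoGenusRedei
import HarnessLib

/-!
# Sub-lane «bsd-p2»: the TWO-PRIME FAMILY `n = p·q`, `p ≡ 3`, `q ≡ 5 (mod 8)` — `BSD(E_{pq}, 2)` for
# EVERY such pair of primes as ONE uniform theorem (door D-CN-6 at `k = 2`, class `7`; p2-typer GEN 4
# offer "T-54-bis" to p2-lead)

HONEST FRAMING (sub-lane «bsd-p2», run/shared/lean/b2b/bsd-rank1-residual/p2/, verbatim in every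
file): the target of record is the FULL Birch–Swinnerton-Dyer formula for EVERY analytic-rank `≤ 1`
`E/ℚ` at ALL primes INCLUDING `2`; the odd-prime class ledger is referee A's; the `2`-part is OPEN
(cells O1 = X5 ∖ CM and O12 = the CM corner) and under census by «bsd-p2». Census / instrument
output at `2` = EVIDENCE / conjecture items with held-out validation, NEVER a Literature fact;
certificates close PAIRS (one isogeny class, `p = 2`), never classes. This file asserts NO
arithmetic fact. WHAT IT DOES, for primes `p ≡ 3 (mod 8)`, `q ≡ 5 (mod 8)`, `n = pq ≡ 7 (mod 8)`:
(§1) the Faulkner–James Laplacian of `G(−pq)` on `(−1, p, q)` is `(0 1 1; 0 0 0; 0 b b)` with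
`b = [(p/q) = −1]` (`p ≡ 3 (mod 4)` has no out-arcs; `−1 → p, q` since `p, q ≡ ±3 (mod 8)`), whose
kernel has `4` elements for EITHER value of `b` — so `ρ(pq) = 0` by p2-monsky-lit's THEOREM
`FaulknerJames2007.rhoIndex_eq_one_of_card_ker` (p323285), uniformly; (§2) the decompositions of `pq`
are `{pq}` and `{p, q}`, and Tian–Yuan–Zhang's SECOND genus sum is `Σ₂(pq) = g(p)·g(q)` (`d₀ = q ≡ 5`,
`d₁ = p ≡ 3`), ODD: `g(p)` by `t = 1` (`P2/CongruentNumberPairsAtTwoPrimeSevenModEight.lean`) and `g(q)`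
because the Rédei matrix of `ℚ(√−q)` on `(2, q)` is `(1 1; 0 0)` (`(q/2) = −1` as `q ≡ 5 (mod 8)`,
`(−4/q) = +1` as `q ≡ 1 (mod 4)`), rank `1 = t − 1` — modulo the displayed Rédei–Reichardt fact `hR`;
(§3) hence TYZ Thm 1.2 (displayed fact `h12`) at `ρ = 0`: `ord_{s=1} L(E_{pq}, s) = 1`,
`L′(E_{pq},1) = 2·𝓛²·Ω·Reg` with `𝓛` odd (`x = 2𝓛²`, `ord₂ x = 1`, NO L-value computed); `pq = p₃p₅` is
Monsky 1990 Cor 5.15 family (2) (displayed fact `h515`: rank `1`, `#Sel₂ = 8`, `Ш[2^∞] = 0`), so the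
D-CN-5 door (p320819; NO Gross–Zagier–Kolyvagin, no Monsky-1994 matrix) gives
`BSD(E_{pq}, 2) ⟺ ord₂ ∏c_ℓ(E_{pq}) = 5`. `#E_{pq}(ℚ)_tor = 4` and `∏c_ℓ(E_{pq}) = 32` are lit-1's THEOREMS
(`torsionOrder_congruentNumberCurve`, p323719; `tamagawaProduct_congruentNumberCurve_of_odd`, p324736, via
`tamagawaProduct_congruentNumberCurve_prod`) — NOTHING per-curve is displayed. NEW IN THE TREE: the D-CN-5 pilot (p321997) displayed the census datum
`x = 2` for `n = 15, 39, 55, 87, 95, 111` (all of shape `p₃q₅`); here `x` is a theorem for ALL such `pq`.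
(The sister shape `p₃q₇ ≡ 5 (mod 8)` is NOT treated: Faulkner–James Thm 1.2 (2), hence §R, is stated
for `n ≡ ±1 (mod 8)` only.) A FAMILY of pairs in the OPEN cell `openO12`, kernel-closed modulo the
displayed facts — not a class closure. Nothing booked; no mark moved. Unit `b2b-bsdres-p2-typer` GEN 4; NEW file.

References: [TianYuanZhang2017] Thm 1.2, §1; [Monsky1990MockHeegner] Cor 5.15 (2); [FaulknerJames2007]
Def 1.5, Thm 1.2 (2); [LiMa2008] Lemma 0.1, Thm 0.4; [Miller2011LMS] Def 1.1; HOME/p2/LEAD-OKS.md T-54.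
-/

noncomputable section

open scoped Classical

open Matrix Finset WeierstrassCurve NumberField Literature.NumberTheory.EllipticCurves
  Literature.NumberTheory.EllipticCurves.Rank1Residual
  Literature.NumberTheory.EllipticCurves.Rank1Residual.Typed
  Literature.NumberTheory.EllipticCurves.Monsky1990
  Literature.NumberTheory.EllipticCurves.TianYuanZhang2017
  Literature.NumberTheory.EllipticCurves.FaulknerJames2007
  Literature.NumberTheory.QuadraticFields.RedeiReichardt

set_option autoImplicit false

namespace Summit.BirchSwinnertonDyer.Rank1Residual.P2

/-! ## §1 `ρ(pq) = 0`: the Faulkner–James Laplacian of `G(−pq)` by hand -/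

/-- **The Laplacian of `G(−pq)`**, `p ≡ 3`, `q ≡ 5 (mod 8)`, on the vertices `(−1, p, q)`: arcs
`−1 → p`, `−1 → q` (both `≡ ±3 (mod 8)`), none out of `p ≡ 3 (mod 4)`, and `q → p` iff `(p/q) = −1`
(`b = kroneckerBit p q`): `L = (0 1 1; 0 0 0; 0 b b)`. [cite: FaulknerJames2007, Def. 1.5 and Def. 5.2] -/
theorem fjLaplacianNeg_three_five {p q : ℕ} (hp3 : p % 8 = 3) (hq5 : q % 8 = 5) :
    fjLaplacianNeg ![p, q] = !![0, 1, 1; 0, 0, 0; 0, kroneckerBit p q, kroneckerBit p q] := by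
  have hp4 : p % 4 ≠ 1 := by omega
  have hq4 : q % 4 = 1 := by omega
  have e0 : (Finset.univ : Finset (Fin 3)).erase 0 = {1, 2} := by decide
  have e1 : (Finset.univ : Finset (Fin 3)).erase 1 = {0, 2} := by decide
  have e2 : (Finset.univ : Finset (Fin 3)).erase 2 = {0, 1} := by decide
  have a01 : fjArcNeg ![p, q] 0 1 = 1 := by
    rw [show (1 : Fin 3) = (0 : Fin 2).succ from rfl, fjArcNeg_zero_succ]; simp [hp3]
  have a02 : fjArcNeg ![p, q] 0 2 = 1 := by
    rw [show (2 : Fin 3) = (1 : Fin 2).succ from rfl, fjArcNeg_zero_succ]; simp [hq5]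
  have a1 : ∀ j, fjArcNeg ![p, q] 1 j = 0 := fun j => by
    rw [show (1 : Fin 3) = (0 : Fin 2).succ from rfl]
    exact fjArcNeg_succ_of_ne _ 0 (by simpa using hp4) j
  have a20 : fjArcNeg ![p, q] 2 0 = 0 := fjArcNeg_zero_right _ 2
  have a21 : fjArcNeg ![p, q] 2 1 = kroneckerBit p q := by
    rw [show (2 : Fin 3) = (1 : Fin 2).succ from rfl, show (1 : Fin 3) = (0 : Fin 2).succ from rfl,
      fjArcNeg_succ_succ]
    simp [hq4]
  have h11 : (1 : ZMod 2) + 1 = 0 := by decide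
  ext i j
  simp only [fjLaplacianNeg, Matrix.of_apply]
  fin_cases i <;> fin_cases j <;> simp [e0, e2, a01, a02, a1, a20, a21, h11]

/-- **`ρ(pq) = 0` for all primes `p ≡ 3`, `q ≡ 5 (mod 8)`**: the Laplacian `(0 1 1; 0 0 0; 0 b b)` has the
`4`-element kernel `{x : x_p = x_q}` for either `b`, so `[E_{pq}(ℚ) : φ(A(ℚ)) + E[2]] = 1` by
p2-monsky-lit's descent theorem. [cite: FaulknerJames2007, Thm. 1.2 (2)] [cite: TianYuanZhang2017, §1 (ρ(n))] -/
theorem rhoIndex_eq_one_three_five {p q : ℕ} (hp : p.Prime) (hq : q.Prime) (hp3 : p % 8 = 3)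
    (hq5 : q % 8 = 5) : (rhoSubgroup (p * q)).index = 1 := by
  have hne : p ≠ q := fun h => by omega
  have hinj : Function.Injective (![p, q] : Fin 2 → ℕ) := by
    intro i j h
    fin_cases i <;> fin_cases j <;> simp_all [hne.symm]
  have hprod : ∏ i, (![p, q] : Fin 2 → ℕ) i = p * q := by simp [Fin.prod_univ_two]
  have h8 : (∏ i, (![p, q] : Fin 2 → ℕ) i) % 8 = 1 ∨ (∏ i, (![p, q] : Fin 2 → ℕ) i) % 8 = 7 := by
    rw [hprod, Nat.mul_mod, hp3, hq5]; norm_num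
  have hcard : Fintype.card {x : Fin 3 → ZMod 2 // fjLaplacianNeg ![p, q] *ᵥ x = 0} = 4 := by
    rw [fjLaplacianNeg_three_five hp3 hq5]
    rcases (by decide : ∀ z : ZMod 2, z = 0 ∨ z = 1) (kroneckerBit p q) with hb | hb <;> rw [hb] <;> decide
  exact rhoIndex_eq_one_of_card_ker ![p, q] (fun i => by fin_cases i <;> assumption) hinj h8 hcard hprod

/-! ## §2 The second genus sum of `pq`: `Σ₂(pq) = g(p)·g(q)`, odd -/

/-- A divisor `> 1` of `pq` (`p, q` prime) is `p`, `q` or `pq`. [folklore] -/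
theorem eq_of_dvd_prime_mul {p q d : ℕ} (hp : p.Prime) (hq : q.Prime) (hd : d ∣ p * q) (h1 : 1 < d) :
    d = p ∨ d = q ∨ d = p * q := by
  obtain ⟨d₁, d₂, h₁, h₂, rfl⟩ := Nat.dvd_mul.mp hd
  rcases (Nat.dvd_prime hp).mp h₁ with h1' | h1' <;> rcases (Nat.dvd_prime hq).mp h₂ with h2' | h2'
  · rw [h1', h2'] at h1; simp at h1
  · rw [h1', h2']; exact Or.inr (Or.inl (one_mul q))
  · rw [h1', h2']; exact Or.inl (mul_one p)
  · rw [h1', h2']; exact Or.inr (Or.inr rfl)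

/-- **`Σ₂(pq; g) = g(p)·g(q)`** for primes `p ≡ 3`, `q ≡ 5 (mod 8)`: the only decomposition of `pq`
admitting `d₀ ≡ 5, 6, 7` and `d₁ ≡ 1, 2, 3 (mod 8)` distinct is `{p, q}` (`{pq}` is a singleton; `pq`
is coprime to neither prime). [cite: TianYuanZhang2017, Thm. 1.2 (Σ₂)] -/
theorem genusSum₂_three_five {p q : ℕ} (hp : p.Prime) (hq : q.Prime) (hp3 : p % 8 = 3)
    (hq5 : q % 8 = 5) (g : ℕ → ℕ) : genusSum₂ (p * q) g = g p * g q := by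
  have hne : p ≠ q := fun h => by omega
  have hpq0 : p * q ≠ 0 := Nat.mul_ne_zero hp.ne_zero hq.ne_zero
  have hcop : Nat.Coprime p q := (Nat.coprime_primes hp hq).mpr hne
  -- the filtered set of decompositions is `{{p, q}}`
  have key : (decompositions (p * q)).filter (fun D => ∃ d₀ ∈ D, ∃ d₁ ∈ D, d₀ ≠ d₁ ∧
      (d₀ % 8 = 5 ∨ d₀ % 8 = 6 ∨ d₀ % 8 = 7) ∧ (d₁ % 8 = 1 ∨ d₁ % 8 = 2 ∨ d₁ % 8 = 3) ∧
      ∀ d ∈ D, d ≠ d₀ → d ≠ d₁ → d % 8 = 1) = {{p, q}} := by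
    apply Finset.eq_singleton_iff_unique_mem.mpr
    constructor
    · simp only [Finset.mem_filter, decompositions, Finset.mem_powerset]
      refine ⟨⟨fun d hd => ?_, fun d hd => ?_, ?_, ?_⟩, q, by simp, p, by simp, hne.symm, Or.inl hq5,
        Or.inr (Or.inr hp3), fun d hd h1 h2 => ?_⟩
      · rw [Nat.mem_divisors]
        simp only [Finset.mem_insert, Finset.mem_singleton] at hd
        rcases hd with rfl | rfl
        · exact ⟨dvd_mul_right d q, hpq0⟩
        · exact ⟨dvd_mul_left d p, hpq0⟩
      · simp only [Finset.mem_insert, Finset.mem_singleton] at hd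
        rcases hd with rfl | rfl
        · exact hp.one_lt
        · exact hq.one_lt
      · intro a ha b hb hab
        simp only [Finset.coe_insert, Finset.coe_singleton, Set.mem_insert_iff,
          Set.mem_singleton_iff] at ha hb
        rcases ha with rfl | rfl <;> rcases hb with rfl | rfl
        · exact absurd rfl hab
        · exact hcop
        · exact hcop.symm
        · exact absurd rfl hab
      · exact Finset.prod_pair hne
      · simp only [Finset.mem_insert, Finset.mem_singleton] at hd
        rcases hd with rfl | rfl
        · exact absurd rfl h2
        · exact absurd rfl h1
    · intro D hD
      simp only [Finset.mem_filter, decompositions, Finset.mem_powerset] at hD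
      obtain ⟨⟨hsub, hgt, hcopr, hprodD⟩, d₀, hd₀, d₁, hd₁, hne01, h₀, h₁, -⟩ := hD
      have hmem : ∀ d ∈ D, d = p ∨ d = q ∨ d = p * q := fun d hd =>
        eq_of_dvd_prime_mul hp hq (Nat.dvd_of_mem_divisors (hsub hd)) (hgt d hd)
      -- `pq ∉ D`: it would have to be coprime to the other element among `d₀, d₁`
      have hnot : p * q ∉ D := by
        intro hmul
        have hc : ∀ d ∈ D, d ≠ p * q → Nat.Coprime (p * q) d := fun d hd hdn => hcopr hmul hd hdn.symm
        rcases eq_or_ne d₀ (p * q) with h0 | h0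
        · have := hc d₁ hd₁ (h0 ▸ hne01.symm)
          rcases hmem d₁ hd₁ with rfl | rfl | h
          · exact (Nat.coprime_primes hp hp).mp (Nat.Coprime.coprime_mul_right this) rfl
          · exact (Nat.coprime_primes hq hq).mp (Nat.Coprime.coprime_mul_left this) rfl
          · exact (h0 ▸ hne01.symm) h
        · have := hc d₀ hd₀ h0
          rcases hmem d₀ hd₀ with rfl | rfl | h
          · exact (Nat.coprime_primes hp hp).mp (Nat.Coprime.coprime_mul_right this) rfl
          · exact (Nat.coprime_primes hq hq).mp (Nat.Coprime.coprime_mul_left this) rfl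
          · exact h0 h
      have hDsub : D ⊆ {p, q} := by
        intro d hd
        rcases hmem d hd with rfl | rfl | rfl
        · simp
        · simp
        · exact absurd hd hnot
      -- both `p` and `q` occur (two distinct elements of a subset of `{p, q}`)
      have hd₀' : d₀ = p ∨ d₀ = q := by simpa using hDsub hd₀
      have hd₁' : d₁ = p ∨ d₁ = q := by simpa using hDsub hd₁
      apply Finset.Subset.antisymm hDsub
      intro d hd
      simp only [Finset.mem_insert, Finset.mem_singleton] at hd
      rcases hd with rfl | rfl
      · rcases hd₀' with rfl | rfl
        · exact hd₀
        · rcases hd₁' with rfl | rfl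
          · exact hd₁
          · exact absurd rfl hne01
      · rcases hd₀' with rfl | rfl
        · rcases hd₁' with rfl | rfl
          · exact absurd rfl hne01
          · exact hd₁
        · exact hd₀
  unfold genusSum₂
  rw [key, Finset.sum_singleton, Finset.prod_pair hne]

/-- **`g(q) = #2Cl(ℚ(√−q))` is odd for a prime `q ≡ 5 (mod 8)`**, modulo Rédei–Reichardt: `D = −4q`,
primes `(2, q)`, `(q/2) = −1` (`q ≡ 5 (mod 8)`) and `(−4/q) = +1` (`q ≡ 1 (mod 4)`), so the Rédei matrix
is `(1 1; 0 0)` of rank `1 = t − 1` — its kernel `{v₀ = v₁}` has `2` elements.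
[cite: LiMa2008, Thm. 0.4 with Lemma 0.1 and Def. 0.2] [cite: TianYuanZhang2017, §1 (g(d))] -/
theorem odd_genusClassNumber_genusField_prime_five_mod_eight (hR : redeiReichardt_fourTwoCard_classGroup)
    {q : ℕ} (hq : q.Prime) (hq5 : q % 8 = 5) : Odd (genusClassNumber (GenusField q)) := by
  have hq4 : q % 4 = 1 := by omega
  have hq2 : q ≠ 2 := fun h => by omega
  have hprod : ∏ i, (![2, q] : Fin 2 → ℕ) i = if q % 4 = 1 then 2 * q else q := by
    rw [if_pos hq4]; simp [Fin.prod_univ_two]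
  have hinj : Function.Injective (![2, q] : Fin 2 → ℕ) := by
    intro i j h
    fin_cases i <;> fin_cases j <;> simp_all
  rw [odd_genusClassNumber_genusField_iff_card_ker hR (ι := Fin 2) ![2, q]
    (fun i => by fin_cases i <;> [exact Nat.prime_two; exact hq]) hinj hprod]
  -- the two symbols
  have hb1 : kroneckerBit (primeDisc q q) 2 = 1 := by
    rw [primeDisc_of_ne_two q hq2, if_pos hq4, kroneckerBit_two]
    rw [if_pos (by omega)]
  have hb2 : kroneckerBit (primeDisc q 2) q = 0 := by
    have hpd : primeDisc q 2 = -4 := by simp [primeDisc, hq4]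
    rw [hpd]
    have hne0 : ((-4 : ℤ) : ZMod q) ≠ 0 := by
      rw [Ne, ZMod.intCast_zmod_eq_zero_iff_dvd]
      intro h
      have h4 : (q : ℤ) ∣ 4 := (dvd_neg.mp h)
      have : q ≤ 4 := Nat.le_of_dvd (by norm_num) (by exact_mod_cast h4)
      omega
    have hj : jacobiSym (-4) q = 1 := by
      rw [show (-4 : ℤ) = -1 * 2 ^ 2 by norm_num, jacobiSym.mul_left,
        jacobiSym.at_neg_one (hq.odd_of_ne_two hq2), ZMod.χ₄_nat_one_mod_four hq4,
        jacobiSym.sq_one' (by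
          rw [Int.gcd_comm]
          exact_mod_cast (Nat.coprime_primes hq Nat.prime_two).mpr hq2), one_mul]
    rcases (by decide : ∀ z : ZMod 2, z = 0 ∨ z = 1) (kroneckerBit (-4) q) with h | h
    · exact h
    · exact absurd ((kroneckerBit_eq_one_iff_jacobiSym hq hq2 hne0).mp h) (by rw [hj]; norm_num)
  have e : (Matrix.of fun a b : Fin 2 =>
      if a = b then ∑ c ∈ univ.erase a, kroneckerBit (primeDisc q ((![2, q] : Fin 2 → ℕ) c))
        ((![2, q] : Fin 2 → ℕ) a)
      else kroneckerBit (primeDisc q ((![2, q] : Fin 2 → ℕ) b)) ((![2, q] : Fin 2 → ℕ) a)) =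
      !![1, 1; 0, 0] := by
    ext a b
    fin_cases a <;> fin_cases b <;> simp [hb1, hb2]
  rw [e]
  decide

/-- For primes `p ≡ 3`, `q ≡ 5 (mod 8)` the genus condition of TYZ Thm 1.2 holds for
`K_d = GenusField d`: `Σ₂(pq) = g(p)·g(q)` is odd. [cite: TianYuanZhang2017, Thm. 1.2 (Σ₂)] [cite: LiMa2008, Thm. 0.4] -/
theorem odd_genusSum₂_genusField_three_five (hR : redeiReichardt_fourTwoCard_classGroup) {p q : ℕ}
    (hp : p.Prime) (hq : q.Prime) (hp3 : p % 8 = 3) (hq5 : q % 8 = 5) :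
    Odd (genusSum₂ (p * q) fun d => genusClassNumber (GenusField d)) := by
  rw [genusSum₂_three_five hp hq hp3 hq5]
  exact (odd_genusClassNumber_genusField_prime hR hp (by omega)).mul
    (odd_genusClassNumber_genusField_prime_five_mod_eight hR hq hq5)

/-! ## §3 The family theorem -/

/-- **THE TWO-PRIME FAMILY `p₃·q₅`.** For primes `p ≡ 3`, `q ≡ 5 (mod 8)`: `ord_{s=1} L(E_{pq}, s) = 1`
and `BSD(E_{pq}, 2)`, modulo `h12` (TYZ Thm 1.2), `hR` (Rédei–Reichardt), `h515` (Monsky 1990 Cor 5.15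
(2): `p₃p₅`) — nothing per-curve displayed. Route: `ρ(pq) = 0` (§1), `Σ₂(pq)` odd (§2) ⇒ TYZ:
`r_an = 1`, `L′ = 2·𝓛²·Ω·Reg`, `𝓛` odd ⇒ D-CN-5 door (rank `1`, `Ш[2^∞] = 0` from Cor 5.15; no GZK) ⇒
`BSD(E_{pq}, 2) ⟺ ord₂ ∏c_ℓ = 5`, and `∏c_ℓ(E_{pq}) = 2⁵`, torsion `= 4` by lit-1's theorems.
[cite: TianYuanZhang2017, Thm. 1.2 and §1 (1.1)] [cite: Monsky1990MockHeegner, Cor. 5.15 (2) (p. 66)]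
[cite: Miller2011LMS, Def. 1.1 (arXiv:1010.2431 p. 3)] -/
theorem bsdp_two_congruentNumberCurve_three_five (h12 : thm12_parity_of_scriptL)
    (hR : redeiReichardt_fourTwoCard_classGroup) (h515 : cor515_rank_eq_one_and_card_selmerGroup_two)
    {p q : ℕ} (hp : p.Prime) (hq : q.Prime) (hp3 : p % 8 = 3) (hq5 : q % 8 = 5) :
    haveI := isElliptic_congruentNumberCurve (Nat.mul_ne_zero hp.ne_zero hq.ne_zero)
    (congruentNumberCurve (p * q)).analyticRank = 1 ∧ BSDp (congruentNumberCurve (p * q)) 2 := by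
  have hne : p ≠ q := fun h => by omega
  haveI := isElliptic_congruentNumberCurve (Nat.mul_ne_zero hp.ne_zero hq.ne_zero)
  haveI : Fact (Nat.Prime 2) := ⟨Nat.prime_two⟩
  have hsq : Squarefree (p * q) := by
    rw [Nat.squarefree_mul ((Nat.coprime_primes hp hq).mpr hne)]
    exact ⟨hp.squarefree, hq.squarefree⟩
  have h8 : (p * q) % 8 = 7 := by rw [Nat.mul_mod, hp3, hq5]
  have hN : IsCor515Family (p * q) := Or.inr (Or.inr (Or.inl ⟨p, q, hp, hq, hp3, Or.inr hq5, rfl⟩))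
  have hρ := rhoIndex_eq_one_three_five hp hq hp3 hq5
  obtain ⟨Lz, hLodd, hr1, hderiv⟩ := rankOneDatum_of_index_eq_one h12 hsq (Or.inr h8) hρ GenusField
    (isGenusFieldFamily_genusField (p * q)) (Or.inr (odd_genusSum₂_genusField_three_five hR hp hq hp3 hq5))
  have hx : deriv (congruentNumberCurve (p * q)).entireLFunction 1 =
      (((2 : ℚ) ^ twoExponent (p * q) * (Lz : ℚ) ^ 2 : ℚ) : ℂ) *
        ((congruentNumberCurve (p * q)).realPeriodRat : ℂ) *
          ((congruentNumberCurve (p * q)).regulator : ℂ) := by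
    rw [hderiv]; push_cast; ring
  have hx0 : (2 : ℚ) ^ twoExponent (p * q) * (Lz : ℚ) ^ 2 ≠ 0 := by
    have hL0' : Lz ≠ 0 := fun h => by simp [h] at hLodd
    have hL0 : (Lz : ℚ) ≠ 0 := by exact_mod_cast hL0'
    exact mul_ne_zero (zpow_ne_zero _ two_ne_zero) (pow_ne_zero _ hL0)
  have hpv : ∀ i, ((![p, q] : Fin 2 → ℕ) i).Prime := fun i => by fin_cases i <;> assumption
  have hov : ∀ i, Odd ((![p, q] : Fin 2 → ℕ) i) := fun i => by
    fin_cases i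
    · exact hp.odd_of_ne_two (fun h => by omega)
    · exact hq.odd_of_ne_two (fun h => by omega)
  have hiv : Function.Injective (![p, q] : Fin 2 → ℕ) := by
    intro i j h; fin_cases i <;> fin_cases j <;> simp_all [hne.symm]
  have hnv : ∏ i, (![p, q] : Fin 2 → ℕ) i = p * q := by simp [Fin.prod_univ_two]
  have he : twoExponent (p * q) = 1 := by
    rw [← hnv, twoExponent_prod_eq _ hpv hov hiv]; norm_num
  obtain ⟨-, hiff⟩ := bsdp_two_congruentNumberCurve_iff_of_cor515 h515 hN
    (torsionOrder_congruentNumberCurve hsq) hx0 hx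
  refine ⟨hr1, hiff.mpr ?_⟩
  rw [padicValRat_two_zpow_mul_sq hLodd, he, tamagawaProduct_congruentNumberCurve_prod _ hpv hov hiv hnv,
    padicValNat.prime_pow]
  norm_num

/-- **THE TWO-PRIME FAMILY `p₃·q₅`: `BSD(E_{pq}, 2)` for ALL primes `p ≡ 3`, `q ≡ 5 (mod 8)`**, modulo
the displayed facts `h12`, `hR`, `h515` — one uniform kernel theorem with NO per-curve input (no
certificate, no L-value, no torsion / Tamagawa datum: both are lit-1's theorems).
[cite: TianYuanZhang2017, Thm. 1.2 and §1 (1.1)] [cite: Monsky1990MockHeegner, Cor. 5.15 (2) (p. 66)]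
[cite: FaulknerJames2007, Thm. 1.2 (2)] [cite: Miller2011LMS, Def. 1.1 (arXiv:1010.2431 p. 3)] -/
theorem forall_bsdp_two_congruentNumberCurve_three_five (h12 : thm12_parity_of_scriptL)
    (hR : redeiReichardt_fourTwoCard_classGroup) (h515 : cor515_rank_eq_one_and_card_selmerGroup_two) :
    ∀ p q : ℕ, p.Prime → q.Prime → p % 8 = 3 → q % 8 = 5 → BSDp (congruentNumberCurve (p * q)) 2 :=
  fun _ _ hp hq hp3 hq5 => (bsdp_two_congruentNumberCurve_three_five h12 hR h515 hp hq hp3 hq5).2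

end Summit.BirchSwinnertonDyer.Rank1Residual.P2

end
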